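import Summits.BirchSwinnertonDyer.BirchSwinnertonDyer.Theorems.ErratumRoadFiveEulerHalfGenusLineTwinsGlue
import Summits.BirchSwinnertonDyer.BirchSwinnertonDyer.Theorems.ErratumRoadFiveEulerHalfGenusClassDefs
import Summits.BirchSwinnertonDyer.BirchSwinnertonDyer.Theorems.ErratumRoadFiveEulerHalfGenusLabelsOddSupply
import Summits.BirchSwinnertonDyer.BirchSwinnertonDyer.Theorems.ClassRecordThreeCornerAtThreeShimuraFamilyProducersLocal
import Summits.BirchSwinnertonDyer.BirchSwinnertonDyer.Theorems.ClassRecordThreeEulerHalvesAtThreeKolyvaginFamilyStanding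
import Summits.BirchSwinnertonDyer.BirchSwinnertonDyer.Theorems.ClassRecordThreeEulerHalvesAtThreeKolyvaginFamilyClassCertificate
import Summits.BirchSwinnertonDyer.BirchSwinnertonDyer.Theorems.KolyvaginDepthDoorKolyvaginDepthSupplyZhangGrossPow
import HarnessLib

/-!
# (b2b-κ) FRAME PRODUCERS for `GenusLine.GenusClassDataSupply` — crux 23444, line `genus` v2.0, rank-2 stub

Crux `stmt-BirchSwinnertonDyer-23444` (`Theses.ErratumRoadFive.EulerHalfPOnlyMultPotMultTwinAtFive`, ASIDE on the route), line
`genus` (pen re-cut b1fafd8edd7a), registered stub `stub_genusClassDataSupply : GenusLine.GenusClassDataSupply` (TwinsDefs l.260).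
This file is step B∕File 1 of the (b2b-κ) ASSEMBLY (line owner's partition 2026-08-29T15:27Z; numbering of imc-p1 g42's plan,
evidence #40 on 23444): the FRAME-LEVEL producers that turn the served `FrameProfile` + a genus setting `S` into the hypotheses of
the cell's datum-generic Kolyvagin-class bricks (`ShimuraWalk.*familyData*`, `JET.KolyvaginFamilyData.*`), BY NAME:

* §1 CURRENCY (adapter B): Zhang–Kolyvagin primes with `M ≤ M(ℓ)` are Gross–Kolyvagin primes with (3.2) mod `p^M`
  (`KolyvaginDepthDoor.isKolyvaginPrime_and_frobEqFrobInfty_pow_of_zhang` + Serre's tower lemma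
  `serre_hasSurjectiveModNGaloisRep_pow_holds`, both landed); the level guard `ℓ ∤ 2·N_W` (Defs III″ §5) and `ℓ ∤ N_{E′}`.
* §2 FRAME FACTS: admissibility of `E(K[m])` (`isAdmissible_pointsSubgroup_family`, `Surj`), bad reduction of `E ⊗ K` above the
  split multiplicative prime `p`, `v ∌ m` above `p`.
* §3 A GENUS DATUM AT EVERY GENUINE LEVEL (adapter A's `∀ δ` instantiation): CM point from the printed fact G1, the root `θ↑`,
  generators∕transversal from the cell's level data.
* §4 THE RECEPTACLE ABOVE `p` for the labelled family `ys` (clause (5) `hrec`): A2b `genusCMSpanNeron_atKolyvaginLevels` moved to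
  `ys m = ±Θ(δ.Q)` through the identification clause of `GenusLabelsSupplyOddAt`.
* §5 THE KUMMER CONDITION OFF `p·m` for ANY family datum (clause (4)∕(1)): A2a `GenusKolyvaginLocalOffP` read on the datum's class
  through `kolyvaginClass_def` (junk `0` off admissibility ∕ invariance) and `smul_toGeomPoints_of_forall_emb`.

HONEST FRAMING: helper theorems, every binder displayed; no stub of the line is closed here; 23444, 19715 and every genus child stay
OPEN; no summit statement is proved; BSD is proved for no curve.
References: [GrossLMS1991] §3 (3.1)–(3.3), Prop. 3.7, §4; [McCallumLMS1991] §4–§5; [WZhang2014] §3 Notations (xii);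
[Jetchev2008] Props. 4.7, 4.9, Cor. 4.8; [SerreAbelianLadic1968] IV §3.4 Lemma 3; [SilvermanAEC2009] VII.5.1.
-/

set_option autoImplicit false
-- D-0017: single-problem summit, so `Summit.BirchSwinnertonDyer.BirchSwinnertonDyer.…` repeats a namespace BY DESIGN.
set_option linter.dupNamespace false

noncomputable section

namespace Summit.BirchSwinnertonDyer.BirchSwinnertonDyer.Theorems.GenusLine

open scoped Classical

open NumberField IsDedekindDomain Field
open WeierstrassCurve Literature.NumberTheory.EllipticCurves
  Literature.NumberTheory.EllipticCurves.ModularForms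
  Literature.NumberTheory.EllipticCurves.KolyvaginCocycle
  Literature.NumberTheory.GaloisRepresentations
open Summit.BirchSwinnertonDyer.Rank1Residual
open Summit.BirchSwinnertonDyer.BirchSwinnertonDyer.Theorems

variable {K : Type} [Field K] [NumberField K]

/-! ## §1 Currency: Zhang–Kolyvagin primes of index `≥ M` ⟹ Gross–Kolyvagin primes with (3.2) mod `p^M` (adapter B) -/

/-- **Adapter B on the served frame** (`p ≥ 5`, `ρ_{E,p}` onto ⟹ `ρ_{E,p^M}` onto by Serre's lemma, PROVED in the tree): a
Zhang–Kolyvagin prime `ℓ` with `M ≤ M(ℓ)` is a Gross–Kolyvagin prime with `Frob_ℓ ∼ Frob_∞` on `E[p^M]`.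
[cite: GrossLMS1991, §3 (3.1)–(3.3)] [cite: WZhang2014, Notations (xii)] [cite: SerreAbelianLadic1968, IV §3.4 Lemma 3] -/
theorem gross_of_zhang_of_frameProfile (W : WeierstrassCurve ℚ) [W.IsElliptic] [W.IsGloballyMinimal]
    (A : WeierstrassCurve ℚ) [A.IsElliptic] [A.IsGloballyMinimal] (p q : ℕ) [Fact p.Prime] [Fact q.Prime]
    (K : Type) [Field K] [NumberField K] (hprof : FrameProfile W A p q K) {M : ℕ} (hM : 1 ≤ M) {ℓ : ℕ}
    (hℓ : Zhang2014.IsKolyvaginPrime (W.conductorNorm ℤ) W K p ℓ) (hℓM : M ≤ Zhang2014.kolyvaginIndex W p ℓ) :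
    IsKolyvaginPrime (W.conductorNorm ℤ) W K p ℓ ∧ FrobEqFrobInfty W K (p ^ M) ℓ := by
  have hp2 : p ≠ 2 := by have := hprof.five_le; omega
  exact KolyvaginDepthDoor.isKolyvaginPrime_and_frobEqFrobInfty_pow_of_zhang W K hprof.quad hp2 hM hprof.surj
    (serre_hasSurjectiveModNGaloisRep_pow_holds W p hprof.five_le hprof.surj M) hℓ hℓM

/-- Adapter B at a LEVEL: on a square-free product `c` of Zhang–Kolyvagin primes with `j ≤ M(c)`, `j ≥ 1`, every prime factor is
a Gross–Kolyvagin prime with (3.2) mod `p^j`. [cite: GrossLMS1991, §3 (3.1)–(3.3)] [cite: WZhang2014, Notations (xii)] -/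
theorem gross_of_zhang_level_of_frameProfile (W : WeierstrassCurve ℚ) [W.IsElliptic] [W.IsGloballyMinimal]
    (A : WeierstrassCurve ℚ) [A.IsElliptic] [A.IsGloballyMinimal] (p q : ℕ) [Fact p.Prime] [Fact q.Prime]
    (K : Type) [Field K] [NumberField K] (hprof : FrameProfile W A p q K) {c : ℕ}
    (hc : ∀ ℓ ∈ c.primeFactors, Zhang2014.IsKolyvaginPrime (W.conductorNorm ℤ) W K p ℓ) {j : ℕ} (hj : 1 ≤ j)
    (hjc : (j : ℕ∞) ≤ Zhang2014.levelIndex W p c) :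
    ∀ ℓ ∈ c.primeFactors, IsKolyvaginPrime (W.conductorNorm ℤ) W K p ℓ ∧ FrobEqFrobInfty W K (p ^ j) ℓ :=
  fun ℓ hℓ ↦ gross_of_zhang_of_frameProfile W A p q K hprof hj (hc ℓ hℓ)
    (Zhang2014.natCast_le_levelIndex_iff.mp hjc ℓ hℓ)

/-- Adapter B, Gross's conditions alone (depth `1 ≤ M(ℓ)` is part of Zhang's definition). [cite: GrossLMS1991, §3 (3.1)–(3.3)] -/
theorem gross_of_zhang_of_frameProfile' (W : WeierstrassCurve ℚ) [W.IsElliptic] [W.IsGloballyMinimal]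
    (A : WeierstrassCurve ℚ) [A.IsElliptic] [A.IsGloballyMinimal] (p q : ℕ) [Fact p.Prime] [Fact q.Prime]
    (K : Type) [Field K] [NumberField K] (hprof : FrameProfile W A p q K) {ℓ : ℕ}
    (hℓ : Zhang2014.IsKolyvaginPrime (W.conductorNorm ℤ) W K p ℓ) :
    IsKolyvaginPrime (W.conductorNorm ℤ) W K p ℓ :=
  (gross_of_zhang_of_frameProfile W A p q K hprof le_rfl hℓ hℓ.2.2.2.2.2).1

/-- **The level guard of the labelled family** (Defs III″ §5): a Zhang–Kolyvagin prime of the served frame (`p ≥ 5`) avoids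
`2·N_W` and is inert in `K`. [cite: GrossLMS1991, §3 (3.1)–(3.3)] -/
theorem levelGuard_of_frameProfile (W : WeierstrassCurve ℚ) [W.IsElliptic] [W.IsGloballyMinimal]
    (A : WeierstrassCurve ℚ) [A.IsElliptic] [A.IsGloballyMinimal] (p q : ℕ) [Fact p.Prime] [Fact q.Prime]
    (K : Type) [Field K] [NumberField K] (hprof : FrameProfile W A p q K) {c : ℕ}
    (hc : ∀ ℓ ∈ c.primeFactors, Zhang2014.IsKolyvaginPrime (W.conductorNorm ℤ) W K p ℓ) :
    ∀ ℓ ∈ c.primeFactors, ¬ ℓ ∣ 2 * W.conductorNorm ℤ ∧ (Ideal.span {(ℓ : 𝓞 K)}).IsPrime := by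
  have hp : p.Prime := Fact.out
  have hp3 : p ≠ 3 := by have := hprof.five_le; omega
  exact fun ℓ hℓ ↦ ⟨not_dvd_two_mul_of_isKolyvaginPrime (hc ℓ hℓ) hp hp3,
    (gross_of_zhang_of_frameProfile' W A p q K hprof (hc ℓ hℓ)).2.2.2.2.1⟩

/-- **Kolyvagin levels are prime to `N_{E′}`** on a genus setting (`E′` and `W` differ by the twist by `d₁ ∣ d_K`, the Kolyvagin
primes are odd, prime to `d_K` and of good reduction for `W`). [cite: GrossLMS1991, §3 (3.1)] -/
theorem coprime_conductor_twin_of_frameProfile (W : WeierstrassCurve ℚ) [W.IsElliptic] [W.IsGloballyMinimal]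
    (A : WeierstrassCurve ℚ) [A.IsElliptic] [A.IsGloballyMinimal] (p q : ℕ) [Fact p.Prime] [Fact q.Prime]
    (K : Type) [Field K] [NumberField K] (S : GenusHeegnerSettingRC W A p q K) (hprof : FrameProfile W A p q K) {c : ℕ}
    (hc0 : c ≠ 0) (hc : ∀ ℓ ∈ c.primeFactors, IsKolyvaginPrime (W.conductorNorm ℤ) W K p ℓ) :
    haveI := S.ell
    c.Coprime (S.E'.conductorNorm ℤ) := by
  haveI := S.ell; haveI := S.min
  have hp : p.Prime := Fact.out
  have hd₁ : S.d₁ ∣ NumberField.discr K := S.hd ▸ dvd_mul_right S.d₁ S.d₂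
  refine (ModularAuxNorm.coprime_of_forall_primeFactors_not_dvd hc0 fun r hr hrN ↦ ?_).symm
  have hK' := hc r hr
  haveI : Fact r.Prime := ⟨Nat.prime_of_mem_primeFactors hr⟩
  have hr2 : r ≠ 2 := GenusKolyvagin.kolyvaginPrime_ne_two W hprof.five_le hp hK'
  have hrd : ¬ (r : ℤ) ∣ S.d₁ := fun h ↦ hK'.2.2.1 (h.trans hd₁)
  have hgoodW : W.HasGoodReductionAtPrime r :=
    not_not.mp (mt (W.dvd_conductorNorm_iff_not_hasGoodReductionAtPrime r).mpr hK'.2.1)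
  have hgoodE := GenusKolyvagin.hasGoodReductionAtPrime_of_twist_presentation W S.E' S.hE' hr2 hrd hgoodW
  exact (S.E'.dvd_conductorNorm_iff_not_hasGoodReductionAtPrime r).mp hrN hgoodE

/-! ## §2 Frame facts: admissibility, bad reduction above `p`, `v ∌ m` above `p` -/

/-- **`hA` on the served frame**: `E(K[m])` is `p^j`-admissible for every family datum at a level `m ≠ 0` (`ρ_{E,p}` onto, `p` odd;
no `p`-power torsion in `E(K[m])` by `RingClassNoTorsion`). In the bricks' binder shape. [cite: McCallumLMS1991, §4 (5)]
[cite: GrossLMS1991, §4 Lemma 4.3] -/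
theorem admissible_family_of_frameProfile (W : WeierstrassCurve ℚ) [W.IsElliptic] [W.IsGloballyMinimal]
    (A : WeierstrassCurve ℚ) [A.IsElliptic] [A.IsGloballyMinimal] (p q : ℕ) [Fact p.Prime] [Fact q.Prime]
    (K : Type) [Field K] [NumberField K] (hprof : FrameProfile W A p q K) (ι : K →+* ℂ) {N : ℕ}
    (ys : (m : ℕ) → (W.baseChange (ringClassField K ι m)).toAffine.Point) :
    ∀ (m : ℕ) (dm : JET.KolyvaginFamilyData W K ι m), dm.y = ys m → Squarefree m →
      (∀ q' ∈ m.primeFactors, IsKolyvaginPrime N W K p q') →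
      ∀ j : ℕ, IsAdmissible (absoluteGaloisGroup K) dm.pointsSubgroup ((p ^ j : ℕ) : ℤ) := by
  have hp : p.Prime := Fact.out
  have hp2 : p ≠ 2 := by have := hprof.five_le; omega
  exact fun m dm _ hm _ j ↦ dm.isAdmissible_pointsSubgroup_family hprof.quad hm.ne_zero hp hp2 hprof.surj j

/-- **`E ⊗ K` has bad reduction at every place above the split multiplicative prime `p`** (`ord_p j < 0` at a multiplicative
prime; good reduction of a base change above `p` would force `ord_p j ≥ 0`). [cite: SilvermanAEC2009, Prop. VII.5.1 (b), VII.5.5] -/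
theorem not_hasGoodReductionAt_of_frameProfile (W : WeierstrassCurve ℚ) [W.IsElliptic] [W.IsGloballyMinimal]
    (A : WeierstrassCurve ℚ) [A.IsElliptic] [A.IsGloballyMinimal] (p q : ℕ) [Fact p.Prime] [Fact q.Prime]
    (K : Type) [Field K] [NumberField K] (hprof : FrameProfile W A p q K)
    (w : HeightOneSpectrum (𝓞 K)) (hw : ((p : ℕ) : 𝓞 K) ∈ w.asIdeal) :
    ¬ (W.baseChange K).HasGoodReductionAt w := by
  intro hgood
  have h1 := EisensteinPrimes.padicValRat_j_neg_of_mult W p hprof.splitp.hasMultiplicativeReductionAtPrime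
  have h2 := Additive.padicValRat_j_nonneg_of_hasGoodReductionAt_baseChange W p hw hgood
  exact absurd h2 (not_le.mpr h1)

/-- `p ∣ N_W` on the served frame (split multiplicative at `p`). [cite: SilvermanAEC2009, Prop. VII.5.1 (b)] -/
theorem dvd_conductorNorm_of_frameProfile (W : WeierstrassCurve ℚ) [W.IsElliptic] [W.IsGloballyMinimal]
    (A : WeierstrassCurve ℚ) [A.IsElliptic] [A.IsGloballyMinimal] (p q : ℕ) [Fact p.Prime] [Fact q.Prime]
    (K : Type) [Field K] [NumberField K] (hprof : FrameProfile W A p q K) : p ∣ W.conductorNorm ℤ :=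
  (W.dvd_conductorNorm_iff_not_hasGoodReductionAtPrime p).mpr
    (Literature.NumberTheory.EllipticCurves.Rank1Residual.not_hasGoodReductionAtPrime_of_hasMultiplicativeReductionAtPrime p
      hprof.splitp.hasMultiplicativeReductionAtPrime)

/-- **A place above `p` does not contain a Kolyvagin level** (its prime factors avoid `N_W ∋ p`). [cite: GrossLMS1991, §3 (3.1)] -/
theorem natCast_not_mem_of_frameProfile (W : WeierstrassCurve ℚ) [W.IsElliptic] [W.IsGloballyMinimal]
    (A : WeierstrassCurve ℚ) [A.IsElliptic] [A.IsGloballyMinimal] (p q : ℕ) [Fact p.Prime] [Fact q.Prime]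
    (K : Type) [Field K] [NumberField K] (hprof : FrameProfile W A p q K) {m : ℕ} (hm0 : m ≠ 0)
    (hm : ∀ ℓ ∈ m.primeFactors, IsKolyvaginPrime (W.conductorNorm ℤ) W K p ℓ)
    (v : HeightOneSpectrum (𝓞 K)) (hv : ((p : ℕ) : 𝓞 K) ∈ v.asIdeal) : (m : 𝓞 K) ∉ v.asIdeal :=
  ShimuraWalk.natCast_not_mem_asIdeal_of_prime_mem v (Fact.out : p.Prime) hv hm0 fun ℓ hℓ hℓp ↦
    (hm ℓ hℓ).2.1 (hℓp ▸ dvd_conductorNorm_of_frameProfile W A p q K hprof)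

/-! ## §3 A genus Kolyvagin datum at every genuine level (adapter A's `∀ δ` instantiation) -/

/-- **A genus datum exists at every square-free level `m` prime to `N_{E′}` with inert prime factors**: the CM point of
conductor `m` on `E′` over `K[m]` (printed fact G1, Gross §3 p. 238), the root `θ↑ ∈ K[m]` of `d₁`, and Kolyvagin's
generators ∕ transversal (the cell's level data). [cite: GrossLMS1991, §3 (p. 238), (3.4)] -/
theorem nonempty_genusKolyvaginDatum (W : WeierstrassCurve ℚ) [W.IsElliptic] [W.IsGloballyMinimal]
    (A : WeierstrassCurve ℚ) [A.IsElliptic] [A.IsGloballyMinimal] (p q : ℕ) [Fact p.Prime] [Fact q.Prime]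
    (K : Type) [Field K] [NumberField K] (S : GenusHeegnerSettingRC W A p q K) (hK : IsImaginaryQuadratic K)
    (hG1 : ∀ (N : ℕ) [NeZero N] (W : WeierstrassCurve ℚ) (K : Type) [Field K] [NumberField K],
      phi_heegnerPointOfConductor_mem_range_map_ringClassField_birch N W K)
    {m : ℕ} (hm : Squarefree m) (hinert : ∀ ℓ ∈ m.primeFactors, (Ideal.span {(ℓ : 𝓞 K)}).IsPrime)
    (hmN : haveI := S.ell; m.Coprime (S.E'.conductorNorm ℤ)) :
    haveI := S.ell; haveI := S.nz
    Nonempty (GenusKolyvaginDatum S.E' K S.ιc S.Dt S.β S.d₁ m) := by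
  haveI := S.ell; haveI := S.min; haveI := S.nz; haveI := S.nf
  have hm0 : m ≠ 0 := hm.ne_zero
  obtain ⟨Q, hQ⟩ := hG1 (S.E'.conductorNorm ℤ) S.E' K hK S.Dt S.β S.ιc m S.hβ hm0 hmN
  have h1m : ringClassField K S.ιc 1 ≤ ringClassField K S.ιc m := ringClassField_mono hK S.ιc (one_dvd m) hm0
  obtain ⟨d, -⟩ := ShimuraWalk.exists_familyData_y_eq (W := S.E') hK S.ιc hm hinert (fun _ ↦ 0)
  exact ⟨⟨Q, hQ, ((1 : ℤ) : ringClassField K S.ιc m) * RingClassField.inclusion S.ιc h1m S.θ,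
    GenusKolyvagin.root_sq_eq S.ιc h1m (Or.inl rfl) S.hθ2 rfl,
    GenusKolyvagin.root_ne_zero S.ιc h1m (Or.inl rfl) S.hθ0 rfl,
    d.σ, d.S, d.zpowers_σ, d.S_subset, d.S_transversal⟩⟩

/-! ## §4 The receptacle above `p` for the labelled family (clause (5)'s `hrec`) -/

/-- **Label (a) for the LABELLED FAMILY above `p`** (Gross–Zagier III (3.1) ∕ Jetchev Prop. 4.9's input): ONE `n′` prime to `p`
with `n′ · (f y(m))_v ∈ E⁰(K_v)` for every `v ∣ p`, every square-free Gross–Kolyvagin level `m` and every `f : K[m] → K̄` — A2b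
`genusCMSpanNeron_atKolyvaginLevels` (stated for CM-presented points `Θ_ϑ(Q)`) moved to `ys m = ±Θ(δ.Q)` through the
identification clause of `GenusLabelsSupplyOddAt` on the genus datum of §3. [cite: GrossZagier1986, III (3.1)]
[cite: GrossLMS1991, §3 Prop. 3.7] [cite: Jetchev2008, Prop. 4.9] -/
theorem receptacle_ys_of_frameProfile (W : WeierstrassCurve ℚ) [W.IsElliptic] [W.IsGloballyMinimal]
    (A : WeierstrassCurve ℚ) [A.IsElliptic] [A.IsGloballyMinimal] (p q : ℕ) [Fact p.Prime] [Fact q.Prime]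
    (K : Type) [Field K] [NumberField K] (S : GenusHeegnerSettingRC W A p q K) (hprof : FrameProfile W A p q K)
    (hG1 : ∀ (N : ℕ) [NeZero N] (W : WeierstrassCurve ℚ) (K : Type) [Field K] [NumberField K],
      phi_heegnerPointOfConductor_mem_range_map_ringClassField_birch N W K)
    {ys : (m : ℕ) → (W.baseChange (ringClassField K S.ιc m : Type)).toAffine.Point}
    (hid : haveI := S.ell; haveI := S.nz; haveI := S.nf
      ∀ (c : ℕ), c ≠ 0 → c.Coprime (S.E'.conductorNorm ℤ) →
      ∀ (δ : GenusKolyvaginDatum S.E' K S.ιc S.Dt S.β S.d₁ c),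
        genusTransport W S.E' S.D S.C₂ S.hWd K S.ιc δ = ys c ∨
          genusTransport W S.E' S.D S.C₂ S.hWd K S.ιc δ = -ys c) :
    ∃ n' : ℤ, IsCoprime (p : ℤ) n' ∧
      ∀ (m : ℕ), Squarefree m → (∀ r ∈ m.primeFactors, IsKolyvaginPrime (W.conductorNorm ℤ) W K p r) →
        ∀ (f : ringClassField K S.ιc m →ₐ[ℚ] AlgebraicClosure K) (v : HeightOneSpectrum (𝓞 K)),
          ((p : ℕ) : 𝓞 K) ∈ v.asIdeal →
          n' • pointsMap (W.baseChange K) (v.adicCompletion K) (Affine.Point.map (W' := W) f (ys m)) ∈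
            X11b.E0Receptacle (W.baseChange K) v := by
  haveI := S.ell; haveI := S.min; haveI := S.nz; haveI := S.nf
  obtain ⟨n', hn', h⟩ := genusCMSpanNeron_atKolyvaginLevels W A p q K S hprof
  refine ⟨n', hn', fun m hm hKol f v hv ↦ ?_⟩
  have hmN := coprime_conductor_twin_of_frameProfile W A p q K S hprof hm.ne_zero hKol
  obtain ⟨δ⟩ := nonempty_genusKolyvaginDatum W A p q K S hprof.quad hG1 hm (fun ℓ hℓ ↦ (hKol ℓ hℓ).2.2.2.2.1) hmN
  have key : n' • pointsMap (W.baseChange K) (v.adicCompletion K)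
      (Affine.Point.map (W' := W) f (genusTransport W S.E' S.D S.C₂ S.hWd K S.ιc δ)) ∈
        X11b.E0Receptacle (W.baseChange K) v :=
    h m hm hKol δ.Q δ.hQ δ.ϑ δ.hϑ2 δ.hϑ0 f v hv
  rcases hid m hm.ne_zero hmN δ with h1 | h1
  · rw [← h1]; exact key
  · -- `ys m = -Θ(δ)`: move the sign out in `E(K̄)` (as geometric points) and use `-x ∈ E⁰ ↔ x ∈ E⁰`
    have e0 : @Eq (geomPoints (W.baseChange K)) (Affine.Point.map (W' := W) f (ys m))
        (@Neg.neg (geomPoints (W.baseChange K)) _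
          (Affine.Point.map (W' := W) f (genusTransport W S.E' S.D S.C₂ S.hWd K S.ιc δ))) := by
      rw [← neg_eq_iff_eq_neg.mpr h1, map_neg]; rfl
    rw [e0, map_neg, smul_neg, neg_mem_iff]; exact key

/-! ## §5 The Kummer condition off `p · m` for ANY family datum (clause (4) ∕ (1)) -/

/-- **Kummer condition at the finite places `v ∤ p·m` for the class of ANY family datum** at a Gross–Kolyvagin level `m` on the
served frame (good places: McCallum Prop. 5.1; bad additive∕ramified places off `p`: A2a `GenusKolyvaginLocalOffP`, landed), read
on the datum's class through `kolyvaginClass_def` (junk `0` off admissibility ∕ invariance) and the rationality of `E(K[m])`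
(`smul_toGeomPoints_of_forall_emb`). [cite: McCallumLMS1991, §5 Prop. 5.1] [cite: GrossLMS1991, §4 Prop. 4.4, (6.4)]
[cite: GrossZagier1986, III (3.1)] -/
theorem kolyvaginClass_mem_selmerLocalKer_offP_of_frameProfile (W : WeierstrassCurve ℚ) [W.IsElliptic]
    [W.IsGloballyMinimal] (A : WeierstrassCurve ℚ) [A.IsElliptic] [A.IsGloballyMinimal] (p q : ℕ) [Fact p.Prime]
    [Fact q.Prime] (K : Type) [Field K] [NumberField K] (hprof : FrameProfile W A p q K) (ι : K →+* ℂ)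
    {m : ℕ} (hm0 : m ≠ 0) (hKol : ∀ r ∈ m.primeFactors, IsKolyvaginPrime (W.conductorNorm ℤ) W K p r)
    (d : JET.KolyvaginFamilyData W K ι m) (M : ℕ)
    (v : HeightOneSpectrum (𝓞 K)) (hv : (m : 𝓞 K) ∉ v.asIdeal) (hvp : ((p : ℕ) : 𝓞 K) ∉ v.asIdeal) :
    d.kolyvaginClass (Fact.out : p.Prime) M ∈
      selmerLocalKer (W.baseChange K) (v.adicCompletion K) ((p ^ M : ℕ) : ℤ) := by
  have hloc : GenusKolyvaginLocalOffP W p K ι :=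
    genusKolyvaginLocalOffP_of_pOnlyMult W p q K hprof.quad ι hprof.five_le hprof.sp hprof.only hprof.jval
  let e : ringClassField K ι m →ₐ[K] AlgebraicClosure K := { d.emb with commutes' := d.emb_apply }
  have hArat : ∀ a ∈ d.pointsSubgroup, ∀ Φ : absoluteGaloisGroup K,
      (∀ x : ringClassField K ι m, Φ • e x = e x) → Φ • a = a := by
    rintro a ⟨P, rfl⟩ Φ hΦ
    exact d.smul_toGeomPoints_of_forall_emb P Φ hΦ
  rw [JET.KolyvaginFamilyData.kolyvaginClass_def]
  split_ifs with h
  · exact hloc hm0 e hKol h.1 hArat h.2 v hv hvp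
  · exact zero_mem _

end Summit.BirchSwinnertonDyer.BirchSwinnertonDyer.Theorems.GenusLine

end
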